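import Summits.ABC.ABC.Theorems.TwistAmplificationSharpModerateLawDeepModuliCuspTransfer
import Summits.ABC.ABC.Theorems.TwistAmplificationSharpModerateLawCuspDispersionDefs

/-!
# Crux `TwistAmplification.SharpModerateLaw` (stmt-ABC-1975), line `deep-moduli-cusp-dispersion`:
the transfer in the line's named objects, `transferD : TransferD` (C⁺′ = `CuspLawD` ⇒ `SharpModerateLaw`)

The registered transfer stub `stub_cuspTransfer` of the line (hypothesis: C⁺′ spelled out over Mathlib;
conclusion: the crux verbatim) is in the tree as `DeepModuli.stub_cuspTransfer`
(`…SharpModerateLawDeepModuliCuspTransfer.lean`).  The line's objects `Nstar`, `cuspSetD`, `CuspLawD`,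
`LawOn`, `TransferD` (`…SharpModerateLawCuspDispersionDefs.lean`) are those spellings verbatim, so the named
statement `TransferD := CuspLawD → SharpModerateLaw` is the registered signature definitionally; this file
records that (kernel-checked: the proof term is the landed stub itself) and discharges the transfer in the
line's composition `sharpModerateLaw_of_transfer_of_regimeLaws`, leaving the crux conditional on exactly the
three regime laws `LawOn ResolvedRegime`, `LawOn DeepRegime`, `LawOn HallRegime`.
-/

namespace Summit.ABC.ABC.Theorems.SharpModerateLaw.CuspDispersion

/-- **`transferD`**: C⁺′ = `CuspLawD` implies the crux `SharpModerateLaw` (the named statement `TransferD`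
of the registered stub `stub_cuspTransfer`; proof term = the landed `DeepModuli.stub_cuspTransfer`, the
named objects unfolding to the registered spelling definitionally). -/
theorem transferD : TransferD := DeepModuli.stub_cuspTransfer

/-- **The crux from the three regime laws** (transfer discharged): `LawOn ResolvedRegime`,
`LawOn DeepRegime`, `LawOn HallRegime` ⊢ `SharpModerateLaw`. -/
theorem sharpModerateLaw_of_regimeLaws (h3 : LawOn ResolvedRegime) (h4 : LawOn DeepRegime)
    (h5 : LawOn HallRegime) : Summit.ABC.ABC.Theses.TwistAmplification.SharpModerateLaw :=
  sharpModerateLaw_of_transfer_of_regimeLaws transferD h3 h4 h5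

end Summit.ABC.ABC.Theorems.SharpModerateLaw.CuspDispersion
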